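import Mathlib.LinearAlgebra.Eigenspace.Basic
import Mathlib.LinearAlgebra.FiniteDimensional.Lemmas
import Literature.NumberTheory.EllipticCurves.SupersingularDensitySerreAssemblyProofs
import HarnessLib

/-!
# Density `0` of the supersingular primes (Serre) — proofs, part 5: the monomial subgroup of
# `GL₂(𝔽_q)` and the fixed points of trace-zero elements

Fifth `…Proofs` file (theorems only, nothing is defined) of the series on the named fact
`WeierstrassCurve.serre_supersingular_density_zero` (`SupersingularDensity`; Serre 1981, §8).
Parts 1–4: `SupersingularDensitySerreProofs`, `…FrobeniusProofs`, `…TraceProofs`,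
`…AssemblyProofs` (the last reduces the fact to natural-density Chebotarev + open image).

This part supplies the finite group theory through which the *natural*-density Chebotarev
hypothesis of part 4 is replaced by the unconditional upper bound of
`LFunctions/ChebotarevNaturalUpperBoundProofs.lean` (prime ideal theorem for the fixed field of a
subgroup `H`, valid for Frobenius classes all of whose elements have many fixed points on `G/H`):

* `exists_monomialSubgroup`, `natCard_monomial_le`, `le_natCard_conj_mem_monomial` — in
  `G = GL₂(𝔽_q)`, `q` odd, the monomial matrices (diagonal or anti-diagonal) form a subgroup `N`
  with `#N ≤ 2q²` such that **every `g ∈ G` of trace zero satisfies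
  `#{y ∈ G : y⁻¹ g y ∈ N} ≥ (q² − 2q)(q − 1)`**: for `v` with `v, gv` independent and `c ∈ 𝔽_qˣ`,
  the matrix `y = [v | c·gv]` conjugates `g` to the anti-diagonal `[[0, −c det g], [c⁻¹, 0]]`
  (as `g² = −det g` by Cayley–Hamilton for `tr g = 0`, `mul_self_eq_neg_det_smul_one_of_trace_eq_zero`),
  and at most `2q` vectors `v` are eigenvectors of `g` (`natCard_cross_eq_zero_le`: two
  eigenvalues `±√(−det g)`, proper eigenspaces since `g` is not scalar when `q` is odd).  So each
  trace-zero `g` has `≥ (q − 3)/2` fixed points on `G/N` (`exists_subgroup_GL2_fixedPoints`),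
  whence the trace-zero Frobenius set has upper density `≤ 2/(q − 3)` — Serre's "`C_ℓ` est de
  mesure nulle" (1981, p. 124) made effective at level `ℓ` without Chebotarev's theorem.
* `exists_mulEquiv_addAut_GL2` — `Aut(A) ≃* GL₂(𝔽_ℓ)` compatibly with traces for an `𝔽_ℓ`-plane
  `A` (the bijection of part 4, `natCard_traceZero_addAut_div_le`, as a group isomorphism).

## References

* [Serre1981] J.-P. Serre, *Quelques applications du théorème de densité de Chebotarev*, Publ.
  Math. IHÉS 54 (1981), pp. 123–124 (a), §8 Remarque 1 (p. 190).
-/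

noncomputable section

open scoped Classical

namespace Literature.NumberTheory.EllipticCurves

/-! ### The monomial subgroup of `GL₂(F)` and conjugation of trace-zero elements into it -/

section Monomial

variable {F : Type*} [Field F]

/-- **Cayley–Hamilton for a trace-zero `2 × 2` matrix**: `M² = −(det M) · 1`. [folklore] -/
theorem mul_self_eq_neg_det_smul_one_of_trace_eq_zero {M : Matrix (Fin 2) (Fin 2) F}
    (hM : Matrix.trace M = 0) : M * M = -(Matrix.det M) • (1 : Matrix (Fin 2) (Fin 2) F) := by
  rw [Matrix.trace_fin_two] at hM
  have h11 : M 1 1 = -M 0 0 := by linear_combination hM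
  ext i j
  fin_cases i <;> fin_cases j <;>
    simp [Matrix.mul_apply, Fin.sum_univ_two, Matrix.det_fin_two, h11] <;> ring

/-- `M (M v) = −(det M) v` for a trace-zero `2 × 2` matrix `M`. [folklore] -/
theorem mulVec_mulVec_of_trace_eq_zero {M : Matrix (Fin 2) (Fin 2) F} (hM : Matrix.trace M = 0)
    (v : Fin 2 → F) : M.mulVec (M.mulVec v) = -(Matrix.det M) • v := by
  rw [Matrix.mulVec_mulVec, mul_self_eq_neg_det_smul_one_of_trace_eq_zero hM, Matrix.smul_mulVec,
    Matrix.one_mulVec]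

/-- **The monomial subgroup.**  The invertible `2 × 2` matrices that are diagonal or anti-diagonal
form a subgroup `N` of `GL₂(F)` (the normaliser of the diagonal torus). [folklore] -/
theorem exists_monomialSubgroup :
    ∃ N : Subgroup (GL (Fin 2) F), ∀ g : GL (Fin 2) F, g ∈ N ↔
      ((g : Matrix (Fin 2) (Fin 2) F) 0 1 = 0 ∧ (g : Matrix (Fin 2) (Fin 2) F) 1 0 = 0) ∨
      ((g : Matrix (Fin 2) (Fin 2) F) 0 0 = 0 ∧ (g : Matrix (Fin 2) (Fin 2) F) 1 1 = 0) := by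
  refine ⟨{ carrier := {g | ((g : Matrix (Fin 2) (Fin 2) F) 0 1 = 0 ∧
                (g : Matrix (Fin 2) (Fin 2) F) 1 0 = 0) ∨
              ((g : Matrix (Fin 2) (Fin 2) F) 0 0 = 0 ∧ (g : Matrix (Fin 2) (Fin 2) F) 1 1 = 0)}
            mul_mem' := ?_
            one_mem' := ?_
            inv_mem' := ?_ }, fun g ↦ Iff.rfl⟩
  · intro a b ha hb
    simp only [Set.mem_setOf_eq, Units.val_mul, Matrix.mul_apply, Fin.sum_univ_two] at ha hb ⊢
    rcases ha with ⟨ha1, ha2⟩ | ⟨ha1, ha2⟩ <;> rcases hb with ⟨hb1, hb2⟩ | ⟨hb1, hb2⟩ <;>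
      simp [ha1, ha2, hb1, hb2]
  · simp only [Set.mem_setOf_eq, Units.val_one]
    left
    simp
  · intro g hg
    simp only [Set.mem_setOf_eq] at hg ⊢
    -- entries of `g⁻¹ g = 1`
    have hdet : Matrix.det (g : Matrix (Fin 2) (Fin 2) F) ≠ 0 := by
      rw [← Matrix.GeneralLinearGroup.val_det_apply]
      exact (Matrix.GeneralLinearGroup.det g).ne_zero
    rw [Matrix.det_fin_two] at hdet
    have hmul : ((g⁻¹ : GL (Fin 2) F) : Matrix (Fin 2) (Fin 2) F) * (g : Matrix (Fin 2) (Fin 2) F) = 1 := by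
      rw [← Units.val_mul, inv_mul_cancel, Units.val_one]
    have e01 := congrFun (congrFun hmul 0) 1
    have e10 := congrFun (congrFun hmul 1) 0
    simp only [Matrix.mul_apply, Fin.sum_univ_two, Matrix.one_apply] at e01 e10
    simp only [Fin.isValue, zero_ne_one, ↓reduceIte, one_ne_zero] at e01 e10
    rcases hg with ⟨h01, h10⟩ | ⟨h00, h11⟩
    · left
      rw [h01, h10] at hdet
      rw [h01] at e01
      rw [h10] at e10
      have h00 : (g : Matrix (Fin 2) (Fin 2) F) 0 0 ≠ 0 := fun h ↦ hdet (by rw [h]; ring)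
      have h11 : (g : Matrix (Fin 2) (Fin 2) F) 1 1 ≠ 0 := fun h ↦ hdet (by rw [h]; ring)
      constructor
      · have : ((g⁻¹ : GL (Fin 2) F) : Matrix (Fin 2) (Fin 2) F) 0 1 * (g : Matrix (Fin 2) (Fin 2) F) 1 1 = 0 := by
          linear_combination e01
        exact (mul_eq_zero.mp this).resolve_right h11
      · have : ((g⁻¹ : GL (Fin 2) F) : Matrix (Fin 2) (Fin 2) F) 1 0 * (g : Matrix (Fin 2) (Fin 2) F) 0 0 = 0 := by
          linear_combination e10
        exact (mul_eq_zero.mp this).resolve_right h00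
    · right
      rw [h00, h11] at hdet
      rw [h11] at e01
      rw [h00] at e10
      have h01 : (g : Matrix (Fin 2) (Fin 2) F) 0 1 ≠ 0 := fun h ↦ hdet (by rw [h]; ring)
      have h10 : (g : Matrix (Fin 2) (Fin 2) F) 1 0 ≠ 0 := fun h ↦ hdet (by rw [h]; ring)
      constructor
      · have : ((g⁻¹ : GL (Fin 2) F) : Matrix (Fin 2) (Fin 2) F) 0 0 * (g : Matrix (Fin 2) (Fin 2) F) 0 1 = 0 := by
          linear_combination e01
        exact (mul_eq_zero.mp this).resolve_right h01
      · have : ((g⁻¹ : GL (Fin 2) F) : Matrix (Fin 2) (Fin 2) F) 1 1 * (g : Matrix (Fin 2) (Fin 2) F) 1 0 = 0 := by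
          linear_combination e10
        exact (mul_eq_zero.mp this).resolve_right h10

/-! ### Eigenvectors of a trace-zero element: at most `2q` of them -/

variable [Fintype F]

omit [Fintype F] in
/-- A nonzero vector `v` with `v ∧ Mv = 0` is an eigenvector of `M`. [folklore] -/
theorem exists_mulVec_eq_smul_of_cross_eq_zero (M : Matrix (Fin 2) (Fin 2) F) {v : Fin 2 → F}
    (hv : v ≠ 0) (h : v 0 * (M.mulVec v) 1 - v 1 * (M.mulVec v) 0 = 0) :
    ∃ μ : F, M.mulVec v = μ • v := by
  by_cases h0 : v 0 = 0
  · have h1 : v 1 ≠ 0 := by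
      intro h1
      apply hv
      ext i
      fin_cases i
      · exact h0
      · exact h1
    refine ⟨(M.mulVec v) 1 / v 1, ?_⟩
    have hM0 : (M.mulVec v) 0 = 0 := by
      rw [h0, zero_mul, zero_sub, neg_eq_zero] at h
      exact (mul_eq_zero.mp h).resolve_left h1
    ext i
    fin_cases i
    · simp [hM0, h0]
    · simp only [Fin.mk_one, Fin.isValue, Pi.smul_apply, smul_eq_mul]
      field_simp
  · refine ⟨(M.mulVec v) 0 / v 0, ?_⟩
    ext i
    fin_cases i
    · simp only [Fin.zero_eta, Fin.isValue, Pi.smul_apply, smul_eq_mul]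
      field_simp
    · simp only [Fin.mk_one, Fin.isValue, Pi.smul_apply, smul_eq_mul]
      field_simp
      linear_combination h

omit [Fintype F] in
/-- An eigenvalue `μ` of a trace-zero `2 × 2` matrix `M` satisfies `μ² = −det M`. [folklore] -/
theorem sq_eq_neg_det_of_mulVec_eq_smul {M : Matrix (Fin 2) (Fin 2) F} (hM : Matrix.trace M = 0)
    {v : Fin 2 → F} (hv : v ≠ 0) {μ : F} (h : M.mulVec v = μ • v) : μ ^ 2 = -Matrix.det M := by
  have h1 := mulVec_mulVec_of_trace_eq_zero hM v
  rw [h, Matrix.mulVec_smul, h, smul_smul] at h1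
  have h2 : (μ * μ - -Matrix.det M) • v = 0 := by rw [sub_smul, h1, sub_self]
  rw [smul_eq_zero] at h2
  rcases h2 with h2 | h2
  · rw [sq]
    exact sub_eq_zero.mp h2
  · exact absurd h2 hv

/-- **An eigenspace of a trace-zero invertible `2 × 2` matrix over a field of odd characteristic
has at most `q` elements**: it is a proper subspace of `F²` (if `M = μ · 1` then
`0 = tr M = 2μ`, so `μ = 0` and `det M = 0`). [folklore] -/
theorem natCard_mulVec_eq_smul_le {M : Matrix (Fin 2) (Fin 2) F} (hM : Matrix.trace M = 0)
    (hdet : Matrix.det M ≠ 0) (h2 : (2 : F) ≠ 0) (μ : F) :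
    Nat.card {v : Fin 2 → F // M.mulVec v = μ • v} ≤ Fintype.card F := by
  set W : Submodule F (Fin 2 → F) := Module.End.eigenspace (Matrix.toLin' M) μ with hW
  have hmem : ∀ v, v ∈ W ↔ M.mulVec v = μ • v := fun v ↦ by
    rw [hW, Module.End.mem_eigenspace_iff, Matrix.toLin'_apply]
  have hcard : Nat.card {v : Fin 2 → F // M.mulVec v = μ • v} = Nat.card W :=
    Nat.card_congr (Equiv.subtypeEquivRight fun v ↦ (hmem v).symm)
  rw [hcard]
  -- `W ≠ ⊤`
  have hne : W ≠ ⊤ := by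
    intro htop
    have hall : ∀ v, M.mulVec v = μ • v := fun v ↦ (hmem v).mp (htop ▸ Submodule.mem_top)
    have hMeq : M = μ • (1 : Matrix (Fin 2) (Fin 2) F) := by
      have h0 := hall (Pi.single 0 1)
      have h1 := hall (Pi.single 1 1)
      have e00 := congrFun h0 0
      have e10 := congrFun h0 1
      have e01 := congrFun h1 0
      have e11 := congrFun h1 1
      simp [Matrix.mulVec, dotProduct, Pi.single_apply] at e00 e10 e01 e11
      ext i j
      fin_cases i <;> fin_cases j <;> simp [e00, e10, e01, e11]
    have htr : Matrix.trace M = 2 * μ := by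
      rw [hMeq, Matrix.trace_smul, Matrix.trace_one]
      simp
      ring
    rw [hM] at htr
    have hμ : μ = 0 := by
      rcases mul_eq_zero.mp htr.symm with h | h
      · exact absurd h h2
      · exact h
    apply hdet
    rw [hMeq, hμ, zero_smul, Matrix.det_zero]
  have hlt := Submodule.finrank_lt hne
  rw [Module.finrank_fin_fun] at hlt
  have hle : Module.finrank F W ≤ 1 := by omega
  rw [Module.natCard_eq_pow_finrank (K := F) (V := W), Nat.card_eq_fintype_card]
  calc Fintype.card F ^ Module.finrank F W ≤ Fintype.card F ^ 1 :=
        Nat.pow_le_pow_right Fintype.card_pos hle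
    _ = Fintype.card F := pow_one _

/-- **At most `2q` vectors `v ∈ F²` have `v ∧ Mv = 0`** for a trace-zero invertible `M` over a
field of odd characteristic with `q` elements: such a `v` is `0` or an eigenvector, for one of the
at most two eigenvalues `±√(−det M)`. [folklore] -/
theorem natCard_cross_eq_zero_le {M : Matrix (Fin 2) (Fin 2) F} (hM : Matrix.trace M = 0)
    (hdet : Matrix.det M ≠ 0) (h2 : (2 : F) ≠ 0) :
    Nat.card {v : Fin 2 → F // v 0 * (M.mulVec v) 1 - v 1 * (M.mulVec v) 0 = 0} ≤
      2 * Fintype.card F := by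
  have hq : 1 ≤ Fintype.card F := Fintype.card_pos
  by_cases hroot : ∃ μ₀ : F, μ₀ ^ 2 = -Matrix.det M
  · obtain ⟨μ₀, hμ₀⟩ := hroot
    -- every such `v` is an eigenvector for `μ₀` or for `-μ₀`
    have hsub : ∀ v : Fin 2 → F, v 0 * (M.mulVec v) 1 - v 1 * (M.mulVec v) 0 = 0 →
        M.mulVec v = μ₀ • v ∨ M.mulVec v = (-μ₀) • v := by
      intro v hv
      by_cases hv0 : v = 0
      · left
        rw [hv0, Matrix.mulVec_zero, smul_zero]
      · obtain ⟨μ, hμ⟩ := exists_mulVec_eq_smul_of_cross_eq_zero M hv0 hv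
        have hsq : μ ^ 2 = μ₀ ^ 2 := by rw [sq_eq_neg_det_of_mulVec_eq_smul hM hv0 hμ, hμ₀]
        rcases sq_eq_sq_iff_eq_or_eq_neg.mp hsq with h | h
        · left; rwa [← h]
        · right; rwa [← h]
    let f : {v : Fin 2 → F // v 0 * (M.mulVec v) 1 - v 1 * (M.mulVec v) 0 = 0} →
        {v : Fin 2 → F // M.mulVec v = μ₀ • v} ⊕ {v : Fin 2 → F // M.mulVec v = (-μ₀) • v} :=
      fun v ↦ if h : M.mulVec v.1 = μ₀ • v.1 then Sum.inl ⟨v.1, h⟩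
        else Sum.inr ⟨v.1, (hsub v.1 v.2).resolve_left h⟩
    have hf : Function.Injective f := by
      intro v w hvw
      simp only [f] at hvw
      split_ifs at hvw with h1 h2 h2
      · have h3 := Sum.inl_injective hvw
        have h4 := congrArg Subtype.val h3
        exact Subtype.ext h4
      · have h3 := Sum.inr_injective hvw
        have h4 := congrArg Subtype.val h3
        exact Subtype.ext h4
    calc Nat.card {v : Fin 2 → F // v 0 * (M.mulVec v) 1 - v 1 * (M.mulVec v) 0 = 0}
        ≤ Nat.card ({v : Fin 2 → F // M.mulVec v = μ₀ • v} ⊕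
            {v : Fin 2 → F // M.mulVec v = (-μ₀) • v}) := Nat.card_le_card_of_injective f hf
      _ = Nat.card {v : Fin 2 → F // M.mulVec v = μ₀ • v} +
            Nat.card {v : Fin 2 → F // M.mulVec v = (-μ₀) • v} := Nat.card_sum
      _ ≤ Fintype.card F + Fintype.card F :=
          add_le_add (natCard_mulVec_eq_smul_le hM hdet h2 μ₀) (natCard_mulVec_eq_smul_le hM hdet h2 (-μ₀))
      _ = 2 * Fintype.card F := by ring
  · -- no eigenvalue: only `v = 0`
    have hsub : ∀ v : Fin 2 → F, v 0 * (M.mulVec v) 1 - v 1 * (M.mulVec v) 0 = 0 → v = 0 := by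
      intro v hv
      by_contra hv0
      obtain ⟨μ, hμ⟩ := exists_mulVec_eq_smul_of_cross_eq_zero M hv0 hv
      exact hroot ⟨μ, sq_eq_neg_det_of_mulVec_eq_smul hM hv0 hμ⟩
    have hsingle : Nat.card {v : Fin 2 → F // v 0 * (M.mulVec v) 1 - v 1 * (M.mulVec v) 0 = 0} ≤ 1 := by
      rw [Nat.card_eq_fintype_card]
      refine Fintype.card_le_one_iff.mpr fun v w ↦ Subtype.ext ?_
      rw [hsub v.1 v.2, hsub w.1 w.2]
    omega

/-- **At least `q² − 2q` vectors `v` have `v, Mv` linearly independent** (`v ∧ Mv ≠ 0`).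
[folklore] -/
theorem le_natCard_cross_ne_zero {M : Matrix (Fin 2) (Fin 2) F} (hM : Matrix.trace M = 0)
    (hdet : Matrix.det M ≠ 0) (h2 : (2 : F) ≠ 0) :
    Fintype.card F ^ 2 - 2 * Fintype.card F ≤
      Nat.card {v : Fin 2 → F // v 0 * (M.mulVec v) 1 - v 1 * (M.mulVec v) 0 ≠ 0} := by
  have htot : Nat.card {v : Fin 2 → F // v 0 * (M.mulVec v) 1 - v 1 * (M.mulVec v) 0 = 0} +
      Nat.card {v : Fin 2 → F // v 0 * (M.mulVec v) 1 - v 1 * (M.mulVec v) 0 ≠ 0} =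
        Fintype.card F ^ 2 := by
    rw [Nat.card_eq_fintype_card, Nat.card_eq_fintype_card, Fintype.card_subtype_compl,
      Nat.add_sub_cancel' (Fintype.card_subtype_le _), Fintype.card_fun, Fintype.card_fin]
  have hbad := natCard_cross_eq_zero_le hM hdet h2
  omega

/-! ### Conjugating a trace-zero element into the monomial subgroup -/

/-- **`#{y ∈ GL₂(F) : y⁻¹ g y ∈ N} ≥ (q² − 2q)(q − 1)` for `tr g = 0`, `N` the monomial subgroup,
`q = #F` odd.**  For `v` with `v ∧ gv ≠ 0` and `c ∈ Fˣ`, the matrix `y = [v | c·gv]` is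
invertible and `g y = y · [[0, −c det g], [c⁻¹, 0]]` (Cayley–Hamilton, `g² = −det g`), so
`y⁻¹ g y` is anti-diagonal; and `(v, c) ↦ y` is injective. [folklore] -/
theorem le_natCard_conj_mem_monomial {N : Subgroup (GL (Fin 2) F)}
    (hN : ∀ g : GL (Fin 2) F, g ∈ N ↔
      ((g : Matrix (Fin 2) (Fin 2) F) 0 1 = 0 ∧ (g : Matrix (Fin 2) (Fin 2) F) 1 0 = 0) ∨
      ((g : Matrix (Fin 2) (Fin 2) F) 0 0 = 0 ∧ (g : Matrix (Fin 2) (Fin 2) F) 1 1 = 0))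
    {g : GL (Fin 2) F} (hg : Matrix.trace (g : Matrix (Fin 2) (Fin 2) F) = 0) (h2 : (2 : F) ≠ 0) :
    (Fintype.card F ^ 2 - 2 * Fintype.card F) * (Fintype.card F - 1) ≤
      Nat.card {y : GL (Fin 2) F // y⁻¹ * g * y ∈ N} := by
  set M : Matrix (Fin 2) (Fin 2) F := (g : Matrix (Fin 2) (Fin 2) F) with hMdef
  have hdet : Matrix.det M ≠ 0 := by
    rw [hMdef, ← Matrix.GeneralLinearGroup.val_det_apply]
    exact (Matrix.GeneralLinearGroup.det g).ne_zero
  -- the matrix `y(v, c) = [v | c·Mv]` and its determinant `c · (v ∧ Mv)`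
  let Y : (Fin 2 → F) → F → Matrix (Fin 2) (Fin 2) F := fun v c ↦
    Matrix.of fun i j ↦ if j = 0 then v i else c * (M.mulVec v) i
  have hYdet : ∀ v c, Matrix.det (Y v c) = c * (v 0 * (M.mulVec v) 1 - v 1 * (M.mulVec v) 0) := by
    intro v c
    rw [Matrix.det_fin_two]
    simp [Y]
    ring
  -- the domain and the map
  let S := {v : Fin 2 → F // v 0 * (M.mulVec v) 1 - v 1 * (M.mulVec v) 0 ≠ 0}
  have hne : ∀ (v : S) (c : Fˣ), Matrix.det (Y v.1 c) ≠ 0 := fun v c ↦ by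
    rw [hYdet]
    exact mul_ne_zero c.ne_zero v.2
  -- `g · y = y · A` with `A` anti-diagonal
  have hconj : ∀ (v : S) (c : Fˣ),
      (Matrix.GeneralLinearGroup.mkOfDetNeZero _ (hne v c))⁻¹ * g *
        Matrix.GeneralLinearGroup.mkOfDetNeZero _ (hne v c) ∈ N := by
    intro v c
    set y := Matrix.GeneralLinearGroup.mkOfDetNeZero _ (hne v c) with hy
    -- the anti-diagonal matrix `A`
    let A : Matrix (Fin 2) (Fin 2) F := Matrix.of ![![0, -(c : F) * Matrix.det M], ![(c : F)⁻¹, 0]]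
    have hMY : M * Y v.1 c = Y v.1 c * A := by
      have h2v := mulVec_mulVec_of_trace_eq_zero hg v.1
      have e0 := congrFun h2v 0
      have e1 := congrFun h2v 1
      simp only [Matrix.mulVec, dotProduct, Fin.sum_univ_two, Pi.smul_apply, smul_eq_mul] at e0 e1
      have hc : (c : F) ≠ 0 := c.ne_zero
      ext i j
      fin_cases i <;> fin_cases j
      · simp [Matrix.mul_apply, Fin.sum_univ_two, Y, A, Matrix.mulVec, dotProduct]
        field_simp
      · simp [Matrix.mul_apply, Fin.sum_univ_two, Y, A, Matrix.mulVec, dotProduct]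
        linear_combination (c : F) * e0
      · simp [Matrix.mul_apply, Fin.sum_univ_two, Y, A, Matrix.mulVec, dotProduct]
        field_simp
      · simp [Matrix.mul_apply, Fin.sum_univ_two, Y, A, Matrix.mulVec, dotProduct]
        linear_combination (c : F) * e1
    have hval : ((y⁻¹ * g * y : GL (Fin 2) F) : Matrix (Fin 2) (Fin 2) F) = A := by
      have hyval : (y : Matrix (Fin 2) (Fin 2) F) = Y v.1 c := by
        rw [hy, Matrix.GeneralLinearGroup.val_mkOfDetNeZero]
      have h1 : ((y⁻¹ * g * y : GL (Fin 2) F) : Matrix (Fin 2) (Fin 2) F) =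
          ((y⁻¹ : GL (Fin 2) F) : Matrix (Fin 2) (Fin 2) F) * (M * Y v.1 c) := by
        rw [Units.val_mul, Units.val_mul, hyval, Matrix.mul_assoc]
      rw [h1, hMY, ← Matrix.mul_assoc, ← hyval, ← Units.val_mul, inv_mul_cancel, Units.val_one,
        Matrix.one_mul]
    rw [hN, hval]
    right
    simp [A]
  let f : S × Fˣ → {y : GL (Fin 2) F // y⁻¹ * g * y ∈ N} := fun p ↦
    ⟨Matrix.GeneralLinearGroup.mkOfDetNeZero _ (hne p.1 p.2), hconj p.1 p.2⟩
  have hf : Function.Injective f := by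
    rintro ⟨v, c⟩ ⟨w, d⟩ h
    have hmat : Y v.1 c = Y w.1 d := by
      have := congrArg (fun y : {y : GL (Fin 2) F // y⁻¹ * g * y ∈ N} ↦
        ((y.1 : GL (Fin 2) F) : Matrix (Fin 2) (Fin 2) F)) h
      simpa [f, Matrix.GeneralLinearGroup.val_mkOfDetNeZero] using this
    have hv : v.1 = w.1 := by
      ext i
      have := congrFun (congrFun hmat i) 0
      simpa [Y] using this
    have hc : (c : F) * (M.mulVec v.1) 0 = d * (M.mulVec v.1) 0 := by
      have := congrFun (congrFun hmat 0) 1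
      simp only [Y, Matrix.of_apply] at this
      simpa [← hv] using this
    have hc' : (c : F) * (M.mulVec v.1) 1 = d * (M.mulVec v.1) 1 := by
      have := congrFun (congrFun hmat 1) 1
      simp only [Y, Matrix.of_apply] at this
      simpa [← hv] using this
    -- `Mv ≠ 0` since `v ∧ Mv ≠ 0`
    have hcd : (c : F) = d := by
      by_cases h0 : (M.mulVec v.1) 0 = 0
      · have h1 : (M.mulVec v.1) 1 ≠ 0 := by
          intro h1
          apply v.2
          rw [h0, h1, mul_zero, mul_zero, sub_self]
        exact mul_right_cancel₀ h1 hc'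
      · exact mul_right_cancel₀ h0 hc
    have hcd' : c = d := Units.ext hcd
    rw [Prod.mk.injEq]
    exact ⟨Subtype.ext hv, hcd'⟩
  haveI : Finite {y : GL (Fin 2) F // y⁻¹ * g * y ∈ N} := inferInstance
  calc (Fintype.card F ^ 2 - 2 * Fintype.card F) * (Fintype.card F - 1)
      ≤ Nat.card S * Nat.card Fˣ := by
        rw [Nat.card_eq_fintype_card (α := Fˣ), Fintype.card_units]
        exact Nat.mul_le_mul_right _ (le_natCard_cross_ne_zero hg hdet h2)
    _ = Nat.card (S × Fˣ) := (Nat.card_prod _ _).symm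
    _ ≤ Nat.card {y : GL (Fin 2) F // y⁻¹ * g * y ∈ N} := Nat.card_le_card_of_injective f hf

/-- **`#N ≤ 2q²`** for the monomial subgroup: a diagonal (resp. anti-diagonal) element is
determined by two entries. [folklore] -/
theorem natCard_monomial_le {N : Subgroup (GL (Fin 2) F)}
    (hN : ∀ g : GL (Fin 2) F, g ∈ N ↔
      ((g : Matrix (Fin 2) (Fin 2) F) 0 1 = 0 ∧ (g : Matrix (Fin 2) (Fin 2) F) 1 0 = 0) ∨
      ((g : Matrix (Fin 2) (Fin 2) F) 0 0 = 0 ∧ (g : Matrix (Fin 2) (Fin 2) F) 1 1 = 0)) :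
    Nat.card N ≤ 2 * Fintype.card F ^ 2 := by
  let f : N → (F × F) ⊕ (F × F) := fun g ↦
    if ((g : GL (Fin 2) F) : Matrix (Fin 2) (Fin 2) F) 0 1 = 0 ∧
        ((g : GL (Fin 2) F) : Matrix (Fin 2) (Fin 2) F) 1 0 = 0 then
      Sum.inl (((g : GL (Fin 2) F) : Matrix (Fin 2) (Fin 2) F) 0 0,
        ((g : GL (Fin 2) F) : Matrix (Fin 2) (Fin 2) F) 1 1)
    else Sum.inr (((g : GL (Fin 2) F) : Matrix (Fin 2) (Fin 2) F) 0 1,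
        ((g : GL (Fin 2) F) : Matrix (Fin 2) (Fin 2) F) 1 0)
  have hf : Function.Injective f := by
    rintro ⟨a, ha⟩ ⟨b, hb⟩ h
    rw [hN] at ha hb
    simp only [f] at h
    split_ifs at h with h1 h2 h2
    · have h' := Sum.inl_injective h
      rw [Prod.mk.injEq] at h'
      refine Subtype.ext (Matrix.GeneralLinearGroup.ext fun i j ↦ ?_)
      fin_cases i <;> fin_cases j
      · exact h'.1
      · simp [h1.1, h2.1]
      · simp [h1.2, h2.2]
      · exact h'.2
    · have h' := Sum.inr_injective h
      rw [Prod.mk.injEq] at h'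
      have ha' := ha.resolve_left h1
      have hb' := hb.resolve_left h2
      refine Subtype.ext (Matrix.GeneralLinearGroup.ext fun i j ↦ ?_)
      fin_cases i <;> fin_cases j
      · simp [ha'.1, hb'.1]
      · exact h'.1
      · exact h'.2
      · simp [ha'.2, hb'.2]
  calc Nat.card N ≤ Nat.card ((F × F) ⊕ (F × F)) := Nat.card_le_card_of_injective f hf
    _ = 2 * Fintype.card F ^ 2 := by
        rw [Nat.card_sum, Nat.card_prod, Nat.card_eq_fintype_card]
        ring

/-- **The fixed-point form.**  Over a finite field `F` with `q` elements, `q` odd, there is a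
subgroup `N ≤ GL₂(F)` such that every trace-zero `g` satisfies
`⌊(q − 3)/2⌋ · #N ≤ #{y : y⁻¹ g y ∈ N}`, i.e. has at least `(q − 3)/2` fixed points on
`GL₂(F)/N`. [folklore] -/
theorem exists_subgroup_GL2_fixedPoints (h2 : (2 : F) ≠ 0) :
    ∃ N : Subgroup (GL (Fin 2) F), ∀ g : GL (Fin 2) F,
      Matrix.trace (g : Matrix (Fin 2) (Fin 2) F) = 0 →
        (Fintype.card F - 3) / 2 * Nat.card N ≤ Nat.card {y : GL (Fin 2) F // y⁻¹ * g * y ∈ N} := by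
  obtain ⟨N, hN⟩ := exists_monomialSubgroup (F := F)
  refine ⟨N, fun g hg ↦ ?_⟩
  have h1 := le_natCard_conj_mem_monomial hN hg h2
  have hN' := natCard_monomial_le hN
  set q := Fintype.card F with hq
  have hq1 : 1 ≤ q := Fintype.card_pos
  -- `((q-3)/2) · #N ≤ ((q-3)/2) · 2q² ≤ (q-3) q² ≤ (q²-2q)(q-1)`
  have h3 : (q - 3) / 2 * Nat.card N ≤ (q - 3) * q ^ 2 := by
    calc (q - 3) / 2 * Nat.card N ≤ (q - 3) / 2 * (2 * q ^ 2) := Nat.mul_le_mul_left _ hN'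
      _ = ((q - 3) / 2 * 2) * q ^ 2 := by ring
      _ ≤ (q - 3) * q ^ 2 := Nat.mul_le_mul_right _ (Nat.div_mul_le_self _ _)
  have h4 : (q - 3) * q ^ 2 ≤ (q ^ 2 - 2 * q) * (q - 1) := by
    rcases lt_or_ge q 3 with hq3 | hq3
    · rw [Nat.sub_eq_zero_of_le hq3.le, zero_mul]
      exact Nat.zero_le _
    · have hle2 : 2 * q ≤ q ^ 2 := by nlinarith
      zify [hq3, hle2, hq1]
      nlinarith
  exact h3.trans (h4.trans h1)

end Monomial

/-! ### `Aut(A) ≃* GL₂(𝔽_ℓ)` compatibly with traces -/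

section AddAutGL

variable {ℓ : ℕ} [Fact ℓ.Prime] (A : Type) [AddCommGroup A] [Module (ZMod ℓ) A]

/-- **`Aut(A) ≅ GL₂(𝔽_ℓ)` as groups, compatibly with traces**, for an `𝔽_ℓ`-plane `A` (an abelian
group with `ℓ²` elements with its `𝔽_ℓ`-module structure): a basis identifies the additive
automorphisms of `A` (all `𝔽_ℓ`-linear) with `GL₂(𝔽_ℓ)` and the `𝔽_ℓ`-linear trace with the matrix
trace.  (The bijection of part 4, `natCard_traceZero_addAut_div_le`, upgraded to a group
isomorphism; Serre 1981, p. 190, Remarque 1: `φ_ℓ` with values in `GL₂(𝔽_ℓ)`.)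
[cite: Serre1981, §8 Remarque 1 (p. 190)] -/
theorem exists_mulEquiv_addAut_GL2 (hA : Nat.card A = ℓ ^ 2) :
    ∃ Φ : Multiplicative (AddAut A) ≃* GL (Fin 2) (ZMod ℓ), ∀ g : Multiplicative (AddAut A),
      Matrix.trace ((Φ g : GL (Fin 2) (ZMod ℓ)) : Matrix (Fin 2) (Fin 2) (ZMod ℓ)) =
        LinearMap.trace (ZMod ℓ) A ((Multiplicative.toAdd g).toAddMonoidHom.toZModLinearMap ℓ) := by
  have hp : ℓ.Prime := Fact.out
  haveI : Finite A := Nat.finite_of_card_ne_zero (by rw [hA]; exact pow_ne_zero _ hp.ne_zero)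
  haveI : Module.Finite (ZMod ℓ) A := Module.Finite.of_finite
  let c : Module.Basis (Fin 2) (ZMod ℓ) A :=
    Module.finBasisOfFinrankEq (ZMod ℓ) A (finrank_eq_two_of_natCard_eq_sq A hA)
  -- additive automorphisms as linear maps
  let lin : AddAut A → (A →ₗ[ZMod ℓ] A) := fun e ↦ e.toAddMonoidHom.toZModLinearMap ℓ
  have hlin : ∀ e x, lin e x = e x := fun e x ↦ rfl
  have hlin_comp_symm : ∀ e : AddAut A, (lin e).comp (lin e.symm) = LinearMap.id := fun e ↦
    LinearMap.ext fun x ↦ by simp [hlin]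
  have hlin_symm_comp : ∀ e : AddAut A, (lin e.symm).comp (lin e) = LinearMap.id := fun e ↦
    LinearMap.ext fun x ↦ by simp [hlin]
  have hlin_mul : ∀ a b : Multiplicative (AddAut A),
      lin (Multiplicative.toAdd (a * b)) = (lin (Multiplicative.toAdd a)).comp (lin (Multiplicative.toAdd b)) :=
    fun a b ↦ LinearMap.ext fun x ↦ rfl
  -- matrices as additive automorphisms
  let aut : GL (Fin 2) (ZMod ℓ) → AddAut A := fun M ↦
    { toFun := Matrix.toLin c c (M : Matrix (Fin 2) (Fin 2) (ZMod ℓ))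
      invFun := Matrix.toLin c c ((M⁻¹ : GL (Fin 2) (ZMod ℓ)) : Matrix (Fin 2) (Fin 2) (ZMod ℓ))
      left_inv := fun x ↦ by
        rw [← LinearMap.comp_apply, ← Matrix.toLin_mul c c c, Units.inv_mul, Matrix.toLin_one,
          LinearMap.id_apply]
      right_inv := fun x ↦ by
        rw [← LinearMap.comp_apply, ← Matrix.toLin_mul c c c, Units.mul_inv, Matrix.toLin_one,
          LinearMap.id_apply]
      map_add' := fun x y ↦ map_add _ x y }
  have haut : ∀ M, lin (aut M) = Matrix.toLin c c (M : Matrix (Fin 2) (Fin 2) (ZMod ℓ)) := fun M ↦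
    LinearMap.ext fun x ↦ rfl
  -- the group isomorphism `Aut(A) ≃* GL₂(𝔽_ℓ)`
  let Φ : Multiplicative (AddAut A) ≃* GL (Fin 2) (ZMod ℓ) :=
    { toFun := fun g ↦
        { val := LinearMap.toMatrix c c (lin (Multiplicative.toAdd g))
          inv := LinearMap.toMatrix c c (lin (Multiplicative.toAdd g).symm)
          val_inv := by rw [← LinearMap.toMatrix_comp c c c, hlin_comp_symm, LinearMap.toMatrix_id]
          inv_val := by rw [← LinearMap.toMatrix_comp c c c, hlin_symm_comp, LinearMap.toMatrix_id] }
      invFun := fun M ↦ Multiplicative.ofAdd (aut M)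
      left_inv := fun g ↦ by
        refine congrArg Multiplicative.ofAdd (AddEquiv.ext fun x ↦ ?_)
        show Matrix.toLin c c (LinearMap.toMatrix c c (lin (Multiplicative.toAdd g))) x = _
        rw [Matrix.toLin_toMatrix]
        rfl
      right_inv := fun M ↦ Units.ext (by
        show LinearMap.toMatrix c c (lin (aut M)) = M
        rw [haut, LinearMap.toMatrix_toLin])
      map_mul' := fun a b ↦ Units.ext (by
        show LinearMap.toMatrix c c (lin (Multiplicative.toAdd (a * b))) =
          LinearMap.toMatrix c c (lin (Multiplicative.toAdd a)) *
            LinearMap.toMatrix c c (lin (Multiplicative.toAdd b))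
        rw [hlin_mul, LinearMap.toMatrix_comp c c c]) }
  refine ⟨Φ, fun g ↦ ?_⟩
  show Matrix.trace (LinearMap.toMatrix c c (lin (Multiplicative.toAdd g))) = _
  rw [← LinearMap.trace_eq_matrix_trace (ZMod ℓ) c]

end AddAutGL

end Literature.NumberTheory.EllipticCurves
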